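import Summits.AtomisticToContinuum.FouriersLaw.Theorems.EmbeddedDrudeMourreDrudeDissolutionStubForceKernelsWaves
import Summits.AtomisticToContinuum.FouriersLaw.Theorems.EmbeddedDrudeMourreDrudeDissolutionStubFreeForceKernelPolynomial
import Summits.AtomisticToContinuum.FouriersLaw.Theorems.EmbeddedDrudeMourreDrudeDissolutionStubWickShellStaticTwoPoint
import HarnessLib

/-!
# The Wick kernels of degrees `2` and `4` as sums over `S₂`, `S₄`; the degree-2 part of the Wick presentation of the
first-order force has no zero-wavenumber component
(helper for stub `stub_forceKernels` (KΦ) of line `gram-pencil-harmonic-chaos`, crux `EmbeddedDrudeMourre.DrudeDissolution`,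
item stmt-AtomisticToContinuum-12593; `--supports` file, closes nothing)

WHAT. (1) `wickKernel` of `HarmonicChaosDecomposition.lean` unfolded in the sectors `(2,2)`, `(1,1)`, `(2,0)`, `(0,2)`
as explicit sums over permutations (`wickKernel_two_two`: `½ Σ_{π ∈ S₄} conj w(c₀) conj w(c₁) w(a₀) w(a₁)`;
`wickKernel_one_one/two_zero/zero_two`; the 24 permutations of `Fin 4` explicitly, `sum_perm_fin_four`).
(2) The Wick presentation of the first-order force `Φ` of the stub: quartic part `f_j`, `c_j` (ten monomials
`r₀q₀³, r₀q₁³, r₀r₋₁³, r₀r₁³, p₀²r₀², p₁²r₀², q₀r₀³, q₁r₀³, r₁r₀³, r₋₁r₀³`), degree-2 part `g_j`, `d_j` (ten pairs with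
pairwise equal/opposite Green-function coefficients), constant `0`, and the EXACT identity `Φ = Σ c_j :φφφφ:(f_j) +
Σ d_j :φφ:(g_j)` on phase space (`presentation_identity`, from the landed `firstOrderForce_apply` and `wick_four` by `ring`).
(3) NO CHAOS-2 COMPONENT AT ZERO WAVENUMBER — in particular no Drude atom: the `(2,0)`, `(1,1)`, `(0,2)` kernels of the
degree-2 part vanish identically (`kernel_*_eq_zero`: rational identities in `e^{ik}`), hence
`Σ_j d_j • wickVector ω₂ 1 (g_j) = 0` in the chaos space (`degree_two_wickVector_eq_zero`; the other sectors vanish by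
`wickKernel_of_ne`).

HOW. `Finset.univ_perm_fin_succ` / `Equiv.Perm.decomposeFin` enumerate `S₄`; the bijections `Fin m ⊕ Fin n ≃ Fin N` of
`wickKernel` are reindexed through `finSumFinEquiv` (`sum_equiv_eq_sum_perm`); `lp.ext` + `Lp.ext` with the a.e.
representatives `coeFn_toL2C` reduce the chaos-space identity to the pointwise kernel identities.
-/

noncomputable section

namespace Summit.AtomisticToContinuum.FouriersLaw.Theorems.DrudeDissolution.GramPencilHarmonicChaos

open MeasureTheory Filter Set Function Topology
open scoped InnerProductSpace ENNReal ComplexConjugate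
open Literature.MathematicalPhysics.KineticTheory
open Literature.MathematicalPhysics.KineticTheory.HeatConduction
open Literature.MathematicalPhysics.KineticTheory.PhononBoltzmann
open HarmonicChaos ProbabilityTheory
open PinnedChainKinetic (𝕋 𝕋3 μ𝕋 μ𝕋3 k₄ sinT)
open scoped Literature.MathematicalPhysics.KineticTheory.HeatConduction.PinnedChainKinetic

/-! ## §1 Sums over the symmetric groups `S₂`, `S₄` and the Wick kernels of degrees `2` and `4` -/

open Equiv in
/-- `decomposeFin.symm (p, e) 2 = swap 0 p (e 1).succ` on `Fin 4`. [folklore] -/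
theorem decomposeFin_symm_apply_two_fin_four (p : Fin 4) (e : Perm (Fin 3)) :
    Equiv.Perm.decomposeFin.symm (p, e) 2 = swap 0 p (e 1).succ := by
  have h : (2 : Fin 4) = (1 : Fin 3).succ := by decide
  rw [h, Equiv.Perm.decomposeFin_symm_apply_succ]

open Equiv in
/-- `decomposeFin.symm (p, e) 3 = swap 0 p (e 2).succ` on `Fin 4`. [folklore] -/
theorem decomposeFin_symm_apply_three_fin_four (p : Fin 4) (e : Perm (Fin 3)) :
    Equiv.Perm.decomposeFin.symm (p, e) 3 = swap 0 p (e 2).succ := by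
  have h : (3 : Fin 4) = (2 : Fin 3).succ := by decide
  rw [h, Equiv.Perm.decomposeFin_symm_apply_succ]

open Equiv in
/-- `decomposeFin.symm (p, e) 2 = swap 0 p (e 1).succ` on `Fin 3`. [folklore] -/
theorem decomposeFin_symm_apply_two_fin_three (p : Fin 3) (e : Perm (Fin 2)) :
    Equiv.Perm.decomposeFin.symm (p, e) 2 = swap 0 p (e 1).succ := by
  have h : (2 : Fin 3) = (1 : Fin 2).succ := by decide
  rw [h, Equiv.Perm.decomposeFin_symm_apply_succ]

/-- **The 24 permutations of `Fin 4`, explicitly.** [folklore] -/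
theorem sum_perm_fin_four {M : Type*} [AddCommMonoid M] (φ : Fin 4 → Fin 4 → Fin 4 → Fin 4 → M) :
    ∑ π : Equiv.Perm (Fin 4), φ (π 0) (π 1) (π 2) (π 3) =
      φ 0 1 2 3 + φ 0 1 3 2 + φ 0 2 1 3 + φ 0 2 3 1 + φ 0 3 2 1 + φ 0 3 1 2
      + φ 1 0 2 3 + φ 1 0 3 2 + φ 1 2 0 3 + φ 1 2 3 0 + φ 1 3 2 0 + φ 1 3 0 2
      + φ 2 1 0 3 + φ 2 1 3 0 + φ 2 0 1 3 + φ 2 0 3 1 + φ 2 3 0 1 + φ 2 3 1 0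
      + φ 3 1 2 0 + φ 3 1 0 2 + φ 3 2 1 0 + φ 3 2 0 1 + φ 3 0 2 1 + φ 3 0 1 2 := by
  simp only [Finset.univ_perm_fin_succ, Finset.sum_map, Fintype.sum_prod_type, Equiv.coe_toEmbedding,
    Equiv.Perm.decomposeFin_symm_apply_zero, Equiv.Perm.decomposeFin_symm_apply_one,
    decomposeFin_symm_apply_two_fin_four, decomposeFin_symm_apply_three_fin_four,
    decomposeFin_symm_apply_two_fin_three,
    Fin.sum_univ_four, Fin.sum_univ_three, Fin.sum_univ_two, Finset.univ_unique, Finset.sum_singleton,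
    Equiv.Perm.default_eq, Equiv.Perm.one_apply]
  simp [Equiv.swap_apply_def]
  abel

/-- The two permutations of `Fin 2`. [folklore] -/
theorem sum_perm_fin_two {M : Type*} [AddCommMonoid M] (φ : Fin 2 → Fin 2 → M) :
    ∑ π : Equiv.Perm (Fin 2), φ (π 0) (π 1) = φ 0 1 + φ 1 0 := by
  rw [Finset.univ_perm_fin_succ, Finset.sum_map, Fintype.sum_prod_type]
  simp [Fin.sum_univ_succ, Equiv.swap_apply_def]

/-- Reindex a sum over bijections `α ≃ β` as a sum over permutations of `β`. [folklore] -/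
theorem sum_equiv_eq_sum_perm {α β M : Type*} [Fintype α] [DecidableEq α] [Fintype β] [DecidableEq β]
    [AddCommMonoid M] (e₀ : α ≃ β) (F : (α ≃ β) → M) :
    ∑ e : α ≃ β, F e = ∑ π : Equiv.Perm β, F (e₀.trans π) := by
  symm
  exact Fintype.sum_equiv (Equiv.equivCongr e₀.symm (Equiv.refl β)) _ _
    (fun π => congrArg F (Equiv.ext fun x => by simp))

/-- **The pair Wick kernel as a sum over `S₄`**: `wickKernel f 2 2 κ = ½ Σ_π conj w(c₀) conj w(c₁) w(a₀) w(a₁)`.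
[cite: Janson1997, Thms 3.9 and 4.1] -/
theorem wickKernel_two_two : ∀ (ω₂ T : ℝ) (f : Fin 4 → TestFn) (κ : Shell 2 2),
    wickKernel ω₂ T f 2 2 κ = (1 / 2 : ℂ) * ∑ π : Equiv.Perm (Fin 4),
      conj (thermalWave ω₂ T (f (π 0)) ((κ : SectorConfig 2 2).1 0)) *
        conj (thermalWave ω₂ T (f (π 1)) ((κ : SectorConfig 2 2).1 1)) *
        (thermalWave ω₂ T (f (π 2)) ((κ : SectorConfig 2 2).2 0) *
          thermalWave ω₂ T (f (π 3)) ((κ : SectorConfig 2 2).2 1)) := by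
  intro ω₂ T f κ
  unfold wickKernel
  rw [sum_equiv_eq_sum_perm (finSumFinEquiv (m := 2) (n := 2))]
  have h2 : ((Real.sqrt ((2 : ℕ).factorial * (2 : ℕ).factorial) : ℝ) : ℂ)⁻¹ = 1 / 2 := by
    have : ((2 : ℕ).factorial : ℝ) * (2 : ℕ).factorial = 2 ^ 2 := by norm_num [Nat.factorial]
    rw [this, Real.sqrt_sq (by norm_num)]
    norm_num
  rw [h2]
  congr 1
  refine Finset.sum_congr rfl fun π _ => ?_
  simp only [Fin.prod_univ_two, Equiv.trans_apply, finSumFinEquiv_apply_left,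
    finSumFinEquiv_apply_right]
  have e0 : (Fin.castAdd 2 (0 : Fin 2) : Fin 4) = 0 := rfl
  have e1 : (Fin.castAdd 2 (1 : Fin 2) : Fin 4) = 1 := rfl
  have e2 : (Fin.natAdd 2 (0 : Fin 2) : Fin 4) = 2 := rfl
  have e3 : (Fin.natAdd 2 (1 : Fin 2) : Fin 4) = 3 := rfl
  rw [e0, e1, e2, e3]

/-- The `(1,1)` Wick kernel of a pair (`k' = k` on the shell). [cite: Janson1997, Thms 3.9 and 4.1] -/
theorem wickKernel_one_one (ω₂ T : ℝ) (f : Fin 2 → TestFn) (κ : Shell 1 1) :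
    wickKernel ω₂ T f 1 1 κ =
      conj (thermalWave ω₂ T (f 0) ((κ : SectorConfig 1 1).1 0)) *
          thermalWave ω₂ T (f 1) ((κ : SectorConfig 1 1).1 0) +
        conj (thermalWave ω₂ T (f 1) ((κ : SectorConfig 1 1).1 0)) *
          thermalWave ω₂ T (f 0) ((κ : SectorConfig 1 1).1 0) := by
  unfold wickKernel
  rw [sum_equiv_eq_sum_perm (finSumFinEquiv (m := 1) (n := 1))]
  simp only [Nat.factorial, Nat.cast_one, mul_one, Real.sqrt_one, Complex.ofReal_one, inv_one, one_mul,
    Fin.prod_univ_one, Equiv.trans_apply, finSumFinEquiv_apply_left, finSumFinEquiv_apply_right,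
    shell_one_one_snd]
  have e0 : (Fin.castAdd 1 (0 : Fin 1) : Fin 2) = 0 := rfl
  have e1 : (Fin.natAdd 1 (0 : Fin 1) : Fin 2) = 1 := rfl
  rw [e0, e1]
  exact sum_perm_fin_two (fun i j => conj (thermalWave ω₂ T (f i) ((κ : SectorConfig 1 1).1 0)) *
    thermalWave ω₂ T (f j) ((κ : SectorConfig 1 1).1 0))

/-- On the `(2,0)` shell the second created momentum is minus the first. [folklore] -/
theorem shell_two_zero_snd (κ : Shell 2 0) : (κ : SectorConfig 2 0).1 1 = -(κ : SectorConfig 2 0).1 0 := by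
  have h := (mem_shell_iff (κ : SectorConfig 2 0)).1 κ.2
  simp only [Fin.sum_univ_two, Finset.univ_eq_empty, Finset.sum_empty, sub_zero] at h
  exact eq_neg_of_add_eq_zero_right h

/-- On the `(0,2)` shell the second annihilated momentum is minus the first. [folklore] -/
theorem shell_zero_two_snd (κ : Shell 0 2) : (κ : SectorConfig 0 2).2 1 = -(κ : SectorConfig 0 2).2 0 := by
  have h := (mem_shell_iff (κ : SectorConfig 0 2)).1 κ.2
  simp only [Fin.sum_univ_two, Finset.univ_eq_empty, Finset.sum_empty, zero_sub, neg_eq_zero] at h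
  exact eq_neg_of_add_eq_zero_right h

/-- The `(2,0)` Wick kernel of a pair. [cite: Janson1997, Thms 3.9 and 4.1] -/
theorem wickKernel_two_zero (ω₂ T : ℝ) (f : Fin 2 → TestFn) (κ : Shell 2 0) :
    wickKernel ω₂ T f 2 0 κ = ((Real.sqrt 2 : ℝ) : ℂ)⁻¹ *
      (conj (thermalWave ω₂ T (f 0) ((κ : SectorConfig 2 0).1 0)) *
          conj (thermalWave ω₂ T (f 1) (-(κ : SectorConfig 2 0).1 0)) +
        conj (thermalWave ω₂ T (f 1) ((κ : SectorConfig 2 0).1 0)) *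
          conj (thermalWave ω₂ T (f 0) (-(κ : SectorConfig 2 0).1 0))) := by
  unfold wickKernel
  rw [sum_equiv_eq_sum_perm (finSumFinEquiv (m := 2) (n := 0))]
  simp only [Nat.factorial, Nat.cast_one, mul_one,
    Fin.prod_univ_two, Fin.prod_univ_zero, Equiv.trans_apply, finSumFinEquiv_apply_left,
    shell_two_zero_snd]
  have e0 : (Fin.castAdd 0 (0 : Fin 2) : Fin 2) = 0 := rfl
  have e1 : (Fin.castAdd 0 (1 : Fin 2) : Fin 2) = 1 := rfl
  simp only [e0, e1]
  rw [sum_perm_fin_two (fun i j => conj (thermalWave ω₂ T (f i) ((κ : SectorConfig 2 0).1 0)) *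
    conj (thermalWave ω₂ T (f j) (-(κ : SectorConfig 2 0).1 0)))]
  norm_num

/-- The `(0,2)` Wick kernel of a pair. [cite: Janson1997, Thms 3.9 and 4.1] -/
theorem wickKernel_zero_two (ω₂ T : ℝ) (f : Fin 2 → TestFn) (κ : Shell 0 2) :
    wickKernel ω₂ T f 0 2 κ = ((Real.sqrt 2 : ℝ) : ℂ)⁻¹ *
      (thermalWave ω₂ T (f 0) ((κ : SectorConfig 0 2).2 0) *
          thermalWave ω₂ T (f 1) (-(κ : SectorConfig 0 2).2 0) +
        thermalWave ω₂ T (f 1) ((κ : SectorConfig 0 2).2 0) *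
          thermalWave ω₂ T (f 0) (-(κ : SectorConfig 0 2).2 0)) := by
  unfold wickKernel
  rw [sum_equiv_eq_sum_perm (finSumFinEquiv (m := 0) (n := 2))]
  simp only [Nat.factorial, Nat.cast_one, one_mul,
    Fin.prod_univ_two, Fin.prod_univ_zero, Equiv.trans_apply, finSumFinEquiv_apply_right,
    shell_zero_two_snd]
  have e0 : (Fin.natAdd 0 (0 : Fin 2) : Fin 2) = 0 := rfl
  have e1 : (Fin.natAdd 0 (1 : Fin 2) : Fin 2) = 1 := rfl
  simp only [e0, e1]
  rw [sum_perm_fin_two (fun i j => thermalWave ω₂ T (f i) ((κ : SectorConfig 0 2).2 0) *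
    thermalWave ω₂ T (f j) (-(κ : SectorConfig 0 2).2 0))]
  norm_num

/-- On the pair shell the second annihilated momentum is `c₀ + c₁ − a₀`. [folklore] -/
theorem shell_two_two_snd (κ : Shell 2 2) :
    (κ : SectorConfig 2 2).2 1 =
      (κ : SectorConfig 2 2).1 0 + (κ : SectorConfig 2 2).1 1 - (κ : SectorConfig 2 2).2 0 := by
  have h := (mem_shell_iff (κ : SectorConfig 2 2)).1 κ.2
  simp only [Fin.sum_univ_two] at h
  rw [sub_eq_zero] at h
  exact eq_sub_of_add_eq' h.symm

/-- The pair resonance function in sector coordinates. [folklore] -/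
theorem sectorPhase_two_two (ω₂ : ℝ) (κ : Shell 2 2) :
    sectorPhase ω₂ κ = PinnedChainKinetic.dispersion ω₂ ((κ : SectorConfig 2 2).1 0) +
      PinnedChainKinetic.dispersion ω₂ ((κ : SectorConfig 2 2).1 1) -
      PinnedChainKinetic.dispersion ω₂ ((κ : SectorConfig 2 2).2 0) -
      PinnedChainKinetic.dispersion ω₂ ((κ : SectorConfig 2 2).2 1) := by
  simp only [sectorPhase, Fin.sum_univ_two]
  ring

/-! ## §2 The degree-2 part of the presentation and its three zero-momentum kernels -/

/-- **(α), sector `(1,1)`**: the one-phonon-charge kernel of the degree-2 part vanishes identically — NO DRUDE ATOM.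
[cite: AokiLukkarinenSpohn2006, §3 eqs. (3.15)–(3.17)] -/
theorem kernel_one_one_eq_zero {ω₂ : ℝ} (hω : 0 < ω₂) (a b : ℝ) (κ : Shell 1 1) :
    ∑ j : Fin 10, ((![3 * a / 2 * (greenFn ω₂ 1 - greenFn ω₂ 0), -(3 * a / 2 * (greenFn ω₂ 1 - greenFn ω₂ 0)), 3 * a / 2 * greenFn ω₂ 0 + 3 * b * ω₂ / 2 * (2 * greenFn ω₂ 0 - 2 * greenFn ω₂ 1), 3 * a / 2 * greenFn ω₂ 0 + 3 * b * ω₂ / 2 * (2 * greenFn ω₂ 0 - 2 * greenFn ω₂ 1), 3 * b / 2 * (2 * greenFn ω₂ 1 - greenFn ω₂ 0 - greenFn ω₂ 2), -(3 * b / 2 * (2 * greenFn ω₂ 1 - greenFn ω₂ 0 - greenFn ω₂ 2)), 3 * b * (2 * greenFn ω₂ 0 - 2 * greenFn ω₂ 1), -(3 * b * (2 * greenFn ω₂ 0 - 2 * greenFn ω₂ 1)), 3 * b / 2 * (2 * greenFn ω₂ 0 - 2 * greenFn ω₂ 1), -(3 * b / 2 * (2 * greenFn ω₂ 0 - 2 *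 greenFn ω₂ 1))] : Fin 10 → ℝ) j : ℂ) * wickKernel ω₂ 1 ((![![(Finsupp.single 0 1, 0), (Finsupp.single 0 1, 0)], ![(Finsupp.single 1 1, 0), (Finsupp.single 1 1, 0)], ![((Finsupp.single 1 1, 0) + (Finsupp.single 0 (-1), 0)), (Finsupp.single 0 1, 0)], ![((Finsupp.single 1 1, 0) + (Finsupp.single 0 (-1), 0)), (Finsupp.single 1 1, 0)], ![((Finsupp.single 0 1, 0) + (Finsupp.single (-1) (-1), 0)), ((Finsupp.single 0 1, 0) + (Finsupp.single (-1) (-1), 0))], ![((Finsupp.single 2 1, 0) + (Finsupp.single 1 (-1), 0)), ((Finsupp.single 2 1, 0) + (Finsupp.single 1 (-1), 0))], ![((Finsupp.single 1 1, 0) + (Finsupp.single 0 (-1), 0)), ((Finsupp.single 0 1, 0) + (Finsupp.single (-1) (-1), 0))], ![((Finsupp.single 1 1, 0) + (Finsupp.single 0 (-1), 0)), ((Finsupp.single 2 1, 0) + (Finsupp.single 1 (-1), 0))], ![(0, Finsupp.single 0 1), (0, Finsupp.single 0 1)], ![(0, Finsupp.single 1 1), (0, Finsupp.single 1 1)]]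 : Fin 10 → Fin 2 → TestFn) j) 1 1 κ = 0 := by
  have hE := expT_ne_zero ((κ : SectorConfig 1 1).1 0)
  have hω' : ((PinnedChainKinetic.dispersion ω₂ ((κ : SectorConfig 1 1).1 0) : ℝ) : ℂ) ≠ 0 :=
    Complex.ofReal_ne_zero.2 (PinnedChainKinetic.dispersion_ne_zero hω _)
  simp only [Fin.sum_univ_succ, Fin.sum_univ_zero, Matrix.cons_val_zero, Matrix.cons_val_succ,
    wickKernel_one_one, Matrix.cons_val_one,
    w_Q0, w_Q1, w_P0, w_P1, w_R0, w_R1, w_Rm, map_mul, map_div₀, map_sub, map_one, map_neg,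
    map_inv₀, map_pow, Complex.conj_ofReal, Complex.conj_I, conj_expT, inv_inv]
  push_cast
  field_simp
  ring

/-- **(α), sector `(2,0)`**: the two-creation kernel of the degree-2 part vanishes identically. [folklore] -/
theorem kernel_two_zero_eq_zero {ω₂ : ℝ} (hω : 0 < ω₂) (a b : ℝ) (κ : Shell 2 0) :
    ∑ j : Fin 10, ((![3 * a / 2 * (greenFn ω₂ 1 - greenFn ω₂ 0), -(3 * a / 2 * (greenFn ω₂ 1 - greenFn ω₂ 0)), 3 * a / 2 * greenFn ω₂ 0 + 3 * b * ω₂ / 2 * (2 * greenFn ω₂ 0 - 2 * greenFn ω₂ 1), 3 * a / 2 * greenFn ω₂ 0 + 3 * b * ω₂ / 2 * (2 * greenFn ω₂ 0 - 2 * greenFn ω₂ 1), 3 * b / 2 * (2 * greenFn ω₂ 1 - greenFn ω₂ 0 - greenFn ω₂ 2), -(3 * b / 2 * (2 * greenFn ω₂ 1 - greenFn ω₂ 0 - greenFn ω₂ 2)), 3 * b * (2 * greenFn ω₂ 0 - 2 * greenFn ω₂ 1), -(3 * b * (2 * greenFn ω₂ 0 - 2 * greenFn ω₂ 1)), 3 *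 b / 2 * (2 * greenFn ω₂ 0 - 2 * greenFn ω₂ 1), -(3 * b / 2 * (2 * greenFn ω₂ 0 - 2 * greenFn ω₂ 1))] : Fin 10 → ℝ) j : ℂ) * wickKernel ω₂ 1 ((![![(Finsupp.single 0 1, 0), (Finsupp.single 0 1, 0)], ![(Finsupp.single 1 1, 0), (Finsupp.single 1 1, 0)], ![((Finsupp.single 1 1, 0) + (Finsupp.single 0 (-1), 0)), (Finsupp.single 0 1, 0)], ![((Finsupp.single 1 1, 0) + (Finsupp.single 0 (-1), 0)), (Finsupp.single 1 1, 0)], ![((Finsupp.single 0 1, 0) + (Finsupp.single (-1) (-1), 0)), ((Finsupp.single 0 1, 0) + (Finsupp.single (-1) (-1), 0))], ![((Finsupp.single 2 1, 0) + (Finsupp.single 1 (-1), 0)), ((Finsupp.single 2 1, 0) + (Finsupp.single 1 (-1), 0))], ![((Finsupp.single 1 1, 0) + (Finsupp.single 0 (-1), 0)), ((Finsupp.single 0 1, 0) + (Finsupp.single (-1) (-1), 0))], ![((Finsupp.single 1 1, 0) + (Finsupp.single 0 (-1), 0)), ((Finsupp.single 2 1, 0) + (Finsupp.single 1 (-1),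 0))], ![(0, Finsupp.single 0 1), (0, Finsupp.single 0 1)], ![(0, Finsupp.single 1 1), (0, Finsupp.single 1 1)]] : Fin 10 → Fin 2 → TestFn) j) 2 0 κ = 0 := by
  have hE := expT_ne_zero ((κ : SectorConfig 2 0).1 0)
  have hω' : ((PinnedChainKinetic.dispersion ω₂ ((κ : SectorConfig 2 0).1 0) : ℝ) : ℂ) ≠ 0 :=
    Complex.ofReal_ne_zero.2 (PinnedChainKinetic.dispersion_ne_zero hω _)
  simp only [Fin.sum_univ_succ, Fin.sum_univ_zero, Matrix.cons_val_zero, Matrix.cons_val_succ,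
    wickKernel_two_zero, Matrix.cons_val_one,
    w_Q0, w_Q1, w_P0, w_P1, w_R0, w_R1, w_Rm, map_mul, map_div₀, map_sub, map_one, map_neg,
    map_inv₀, map_pow, Complex.conj_ofReal, Complex.conj_I, conj_expT,
    expT_neg, PinnedChainKinetic.dispersion_neg, inv_inv]
  push_cast
  field_simp
  ring

/-- **(α), sector `(0,2)`**: the two-annihilation kernel of the degree-2 part vanishes identically. [folklore] -/
theorem kernel_zero_two_eq_zero {ω₂ : ℝ} (hω : 0 < ω₂) (a b : ℝ) (κ : Shell 0 2) :
    ∑ j : Fin 10, ((![3 * a / 2 * (greenFn ω₂ 1 - greenFn ω₂ 0), -(3 * a / 2 * (greenFn ω₂ 1 - greenFn ω₂ 0)), 3 * a / 2 * greenFn ω₂ 0 + 3 * b * ω₂ / 2 * (2 * greenFn ω₂ 0 - 2 * greenFn ω₂ 1), 3 * a / 2 * greenFn ω₂ 0 + 3 * b * ω₂ / 2 * (2 * greenFn ω₂ 0 - 2 * greenFn ω₂ 1), 3 * b / 2 * (2 * greenFn ω₂ 1 - greenFn ω₂ 0 - greenFn ω₂ 2), -(3 * b / 2 * (2 * greenFn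 ω₂ 1 - greenFn ω₂ 0 - greenFn ω₂ 2)), 3 * b * (2 * greenFn ω₂ 0 - 2 * greenFn ω₂ 1), -(3 * b * (2 * greenFn ω₂ 0 - 2 * greenFn ω₂ 1)), 3 * b / 2 * (2 * greenFn ω₂ 0 - 2 * greenFn ω₂ 1), -(3 * b / 2 * (2 * greenFn ω₂ 0 - 2 * greenFn ω₂ 1))] : Fin 10 → ℝ) j : ℂ) * wickKernel ω₂ 1 ((![![(Finsupp.single 0 1, 0), (Finsupp.single 0 1, 0)], ![(Finsupp.single 1 1, 0), (Finsupp.single 1 1, 0)], ![((Finsupp.single 1 1, 0) + (Finsupp.single 0 (-1), 0)), (Finsupp.single 0 1, 0)], ![((Finsupp.single 1 1, 0) + (Finsupp.single 0 (-1), 0)), (Finsupp.single 1 1, 0)], ![((Finsupp.single 0 1, 0) + (Finsupp.single (-1) (-1), 0)), ((Finsupp.single 0 1, 0) + (Finsupp.single (-1) (-1), 0))], ![((Finsupp.single 2 1, 0) + (Finsupp.single 1 (-1), 0)), ((Finsupp.single 2 1, 0) + (Finsupp.single 1 (-1), 0))], ![((Finsupp.single 1 1, 0) + (Finsupp.single 0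 (-1), 0)), ((Finsupp.single 0 1, 0) + (Finsupp.single (-1) (-1), 0))], ![((Finsupp.single 1 1, 0) + (Finsupp.single 0 (-1), 0)), ((Finsupp.single 2 1, 0) + (Finsupp.single 1 (-1), 0))], ![(0, Finsupp.single 0 1), (0, Finsupp.single 0 1)], ![(0, Finsupp.single 1 1), (0, Finsupp.single 1 1)]] : Fin 10 → Fin 2 → TestFn) j) 0 2 κ = 0 := by
  have hE := expT_ne_zero ((κ : SectorConfig 0 2).2 0)
  have hω' : ((PinnedChainKinetic.dispersion ω₂ ((κ : SectorConfig 0 2).2 0) : ℝ) : ℂ) ≠ 0 :=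
    Complex.ofReal_ne_zero.2 (PinnedChainKinetic.dispersion_ne_zero hω _)
  simp only [Fin.sum_univ_succ, Fin.sum_univ_zero, Matrix.cons_val_zero, Matrix.cons_val_succ,
    wickKernel_zero_two, Matrix.cons_val_one,
    w_Q0, w_Q1, w_P0, w_P1, w_R0, w_R1, w_Rm,
    expT_neg, PinnedChainKinetic.dispersion_neg, inv_inv]
  push_cast
  field_simp
  ring

/-! ## §4 No degree-2 component at zero wavenumber -/

/-- Finite linear combinations of `L²` classes of `L²` functions, pointwise. [folklore] -/
theorem coeFn_sum_smul_toL2C {X : Type*} [MeasurableSpace X] {ν : Measure X} {ι : Type*} [DecidableEq ι]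
    (c : ι → ℂ) (K : ι → X → ℂ) (hK : ∀ i, MemLp (K i) 2 ν) (t : Finset ι) :
    (⇑(∑ i ∈ t, c i • toL2C ν (K i)) : X → ℂ) =ᵐ[ν] fun x => ∑ i ∈ t, c i * K i x := by
  induction t using Finset.induction_on with
  | empty =>
    filter_upwards [Lp.coeFn_zero ℂ 2 ν] with x hx
    simp only [Finset.sum_empty]
    exact hx
  | insert a t hat ih =>
    rw [Finset.sum_insert hat]
    filter_upwards [Lp.coeFn_add (c a • toL2C ν (K a)) (∑ i ∈ t, c i • toL2C ν (K i)),
      Lp.coeFn_smul (c a) (toL2C ν (K a)), coeFn_toL2C (hK a), ih] with x h1 h2 h3 h4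
    rw [h1, Pi.add_apply, h2, Pi.smul_apply, h3, h4, smul_eq_mul, Finset.sum_insert hat]

/-- A finite linear combination of `L²` classes whose pointwise combination vanishes is `0`. [folklore] -/
theorem sum_smul_toL2C_eq_zero {X : Type*} [MeasurableSpace X] {ν : Measure X} {ι : Type*} [DecidableEq ι]
    (c : ι → ℂ) (K : ι → X → ℂ) (hK : ∀ i, MemLp (K i) 2 ν) (t : Finset ι)
    (h0 : ∀ x, ∑ i ∈ t, c i * K i x = 0) : ∑ i ∈ t, c i • toL2C ν (K i) = 0 := by
  refine Lp.ext ?_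
  filter_upwards [coeFn_sum_smul_toL2C c K hK t, Lp.coeFn_zero ℂ 2 ν] with x h1 h2
  rw [h1, h2, Pi.zero_apply, h0 x]

/-- **(α) NO CHAOS-2 COMPONENT AT ZERO WAVENUMBER** (in particular no Drude atom): the chaos vector of the
degree-2 part of the presentation vanishes. [cite: AokiLukkarinenSpohn2006, §3 eqs. (3.15)–(3.17)] -/
theorem degree_two_wickVector_eq_zero : ∀ {ω₂ : ℝ}, 0 < ω₂ → ∀ a b : ℝ,
    (∑ j : Fin 10, ((![3 * a / 2 * (greenFn ω₂ 1 - greenFn ω₂ 0), -(3 * a / 2 * (greenFn ω₂ 1 - greenFn ω₂ 0)), 3 * a / 2 * greenFn ω₂ 0 + 3 * b * ω₂ / 2 * (2 * greenFn ω₂ 0 - 2 * greenFn ω₂ 1), 3 * a / 2 * greenFn ω₂ 0 + 3 * b * ω₂ / 2 * (2 * greenFn ω₂ 0 - 2 * greenFn ω₂ 1), 3 * b / 2 * (2 * greenFn ω₂ 1 - greenFn ω₂ 0 - greenFn ω₂ 2), -(3 * b / 2 * (2 * greenFn ω₂ 1 - greenFn ω₂ 0 - greenFn ω₂ 2)), 3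 * b * (2 * greenFn ω₂ 0 - 2 * greenFn ω₂ 1), -(3 * b * (2 * greenFn ω₂ 0 - 2 * greenFn ω₂ 1)), 3 * b / 2 * (2 * greenFn ω₂ 0 - 2 * greenFn ω₂ 1), -(3 * b / 2 * (2 * greenFn ω₂ 0 - 2 * greenFn ω₂ 1))] : Fin 10 → ℝ) j : ℂ) • wickVector ω₂ 1 ((![![(Finsupp.single 0 1, 0), (Finsupp.single 0 1, 0)], ![(Finsupp.single 1 1, 0), (Finsupp.single 1 1, 0)], ![((Finsupp.single 1 1, 0) + (Finsupp.single 0 (-1), 0)), (Finsupp.single 0 1, 0)], ![((Finsupp.single 1 1, 0) + (Finsupp.single 0 (-1), 0)), (Finsupp.single 1 1, 0)], ![((Finsupp.single 0 1, 0) + (Finsupp.single (-1) (-1), 0)), ((Finsupp.single 0 1, 0) + (Finsupp.single (-1) (-1), 0))], ![((Finsupp.single 2 1, 0) + (Finsupp.single 1 (-1), 0)), ((Finsupp.single 2 1, 0) + (Finsupp.single 1 (-1), 0))], ![((Finsupp.single 1 1, 0) + (Finsupp.single 0 (-1), 0)), ((Finsupp.single 0 1, 0) + (Finsupp.single (-1)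 (-1), 0))], ![((Finsupp.single 1 1, 0) + (Finsupp.single 0 (-1), 0)), ((Finsupp.single 2 1, 0) + (Finsupp.single 1 (-1), 0))], ![(0, Finsupp.single 0 1), (0, Finsupp.single 0 1)], ![(0, Finsupp.single 1 1), (0, Finsupp.single 1 1)]] : Fin 10 → Fin 2 → TestFn) j)) = 0 := by
  intro ω₂ hω a b
  apply lp.ext
  rw [lp.coeFn_sum]
  funext s
  simp only [Finset.sum_apply, lp.coeFn_smul, Pi.smul_apply, wickVector_apply, lp.coeFn_zero, Pi.zero_apply]
  by_cases hs : s.cr + s.an = 2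
  · obtain ⟨⟨m, n⟩, hmn⟩ := s
    change m + n = 2 at hs
    change ∑ j : Fin 10, ((![3 * a / 2 * (greenFn ω₂ 1 - greenFn ω₂ 0), -(3 * a / 2 * (greenFn ω₂ 1 - greenFn ω₂ 0)), 3 * a / 2 * greenFn ω₂ 0 + 3 * b * ω₂ / 2 * (2 * greenFn ω₂ 0 - 2 * greenFn ω₂ 1), 3 * a / 2 * greenFn ω₂ 0 + 3 * b * ω₂ / 2 * (2 * greenFn ω₂ 0 - 2 * greenFn ω₂ 1), 3 * b / 2 * (2 * greenFn ω₂ 1 - greenFn ω₂ 0 - greenFn ω₂ 2), -(3 * b / 2 * (2 * greenFn ω₂ 1 - greenFn ω₂ 0 - greenFn ω₂ 2)), 3 * b * (2 * greenFn ω₂ 0 - 2 * greenFn ω₂ 1), -(3 * b * (2 * greenFn ω₂ 0 - 2 * greenFn ω₂ 1)), 3 * b / 2 * (2 * greenFn ω₂ 0 - 2 * greenFn ω₂ 1), -(3 * b / 2 * (2 * greenFn ω₂ 0 - 2 * greenFn ω₂ 1))] : Fin 10 → ℝ) j : ℂ) • toL2C (shellMeasure m n) (wickKernel ω₂ 1 ((![![(Finsupp.single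 0 1, 0), (Finsupp.single 0 1, 0)], ![(Finsupp.single 1 1, 0), (Finsupp.single 1 1, 0)], ![((Finsupp.single 1 1, 0) + (Finsupp.single 0 (-1), 0)), (Finsupp.single 0 1, 0)], ![((Finsupp.single 1 1, 0) + (Finsupp.single 0 (-1), 0)), (Finsupp.single 1 1, 0)], ![((Finsupp.single 0 1, 0) + (Finsupp.single (-1) (-1), 0)), ((Finsupp.single 0 1, 0) + (Finsupp.single (-1) (-1), 0))], ![((Finsupp.single 2 1, 0) + (Finsupp.single 1 (-1), 0)), ((Finsupp.single 2 1, 0) + (Finsupp.single 1 (-1), 0))], ![((Finsupp.single 1 1, 0) + (Finsupp.single 0 (-1), 0)), ((Finsupp.single 0 1, 0) + (Finsupp.single (-1) (-1), 0))], ![((Finsupp.single 1 1, 0) + (Finsupp.single 0 (-1), 0)), ((Finsupp.single 2 1, 0) + (Finsupp.single 1 (-1), 0))], ![(0, Finsupp.single 0 1), (0, Finsupp.single 0 1)], ![(0, Finsupp.single 1 1), (0, Finsupp.single 1 1)]] : Fin 10 → Fin 2 → TestFn) j) m n) = 0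
    have hK : ∀ j : Fin 10, MemLp (wickKernel ω₂ 1 ((![![(Finsupp.single 0 1, 0), (Finsupp.single 0 1, 0)], ![(Finsupp.single 1 1, 0), (Finsupp.single 1 1, 0)], ![((Finsupp.single 1 1, 0) + (Finsupp.single 0 (-1), 0)), (Finsupp.single 0 1, 0)], ![((Finsupp.single 1 1, 0) + (Finsupp.single 0 (-1), 0)), (Finsupp.single 1 1, 0)], ![((Finsupp.single 0 1, 0) + (Finsupp.single (-1) (-1), 0)), ((Finsupp.single 0 1, 0) + (Finsupp.single (-1) (-1), 0))], ![((Finsupp.single 2 1, 0) + (Finsupp.single 1 (-1), 0)), ((Finsupp.single 2 1, 0) + (Finsupp.single 1 (-1), 0))], ![((Finsupp.single 1 1, 0) + (Finsupp.single 0 (-1), 0)), ((Finsupp.single 0 1, 0) + (Finsupp.single (-1) (-1), 0))], ![((Finsupp.single 1 1, 0) + (Finsupp.single 0 (-1), 0)), ((Finsupp.single 2 1, 0) + (Finsupp.single 1 (-1), 0))], ![(0, Finsupp.single 0 1), (0, Finsupp.single 0 1)], ![(0, Finsupp.single 1 1), (0, Finsupp.single 1 1)]] : Fin 10 → Fin 2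 → TestFn) j) m n) 2 (shellMeasure m n) := fun j =>
      memLp_two_of_continuous_shell (continuous_wickKernel hω 1 _ m n)
    rcases (show m = 0 ∧ n = 2 ∨ m = 1 ∧ n = 1 ∨ m = 2 ∧ n = 0 by omega) with ⟨rfl, rfl⟩ | ⟨rfl, rfl⟩ | ⟨rfl, rfl⟩
    · exact sum_smul_toL2C_eq_zero _ _ hK _ (kernel_zero_two_eq_zero hω a b)
    · exact sum_smul_toL2C_eq_zero _ _ hK _ (kernel_one_one_eq_zero hω a b)
    · exact sum_smul_toL2C_eq_zero _ _ hK _ (kernel_two_zero_eq_zero hω a b)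
  · simp only [wickKernel_of_ne ω₂ 1 _ hs, toL2C_zero, smul_zero, Finset.sum_const_zero]

/-! ## §5 The presentation identity `Φ = Σ c_j :φφφφ:(f_j) + Σ d_j :φφ:(g_j)` -/

/-- **THE WICK PRESENTATION OF THE FIRST-ORDER FORCE** (exact, as functions on phase space; the constant term is `0`).
[cite: Janson1997, Thm 3.15] -/
theorem presentation_identity (ω₂ a b : ℝ) (σ : ChainConfig) :
    (fun σ : ChainConfig => liouvilleZ (pinnedChain ω₂ a b 1) (fun σ => (pinnedChain ω₂ 0 0 1).bondCurrentZ σ 0) σ - liouvilleZ (pinnedChain ω₂ 0 0 1) (fun σ => (pinnedChain ω₂ 0 0 1).bondCurrentZ σ 0) σ + b * (liouvilleZ (pinnedChain ω₂ 0 0 1) (fun σ => (pinnedChain ω₂ 0 1 1).bondCurrentZ σ 0) σ - liouvilleZ (pinnedChain ω₂ 0 0 1) (fun σ => (pinnedChain ω₂ 0 0 1).bondCurrentZ σ 0) σ)) σ =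
      (fun σ : ChainConfig => (∑ j : Fin 10, (![a / 2, a / 2, b / 2, -(b / 2), 3 * b / 2, -(3 * b / 2), b * ω₂ / 2, b * ω₂ / 2, -(b / 2), b / 2] : Fin 10 → ℝ) j * wick ω₂ 1 4 ((![![((Finsupp.single 1 1, 0) + (Finsupp.single 0 (-1), 0)), (Finsupp.single 0 1, 0), (Finsupp.single 0 1, 0), (Finsupp.single 0 1, 0)], ![((Finsupp.single 1 1, 0) + (Finsupp.single 0 (-1), 0)), (Finsupp.single 1 1, 0), (Finsupp.single 1 1, 0), (Finsupp.single 1 1, 0)], ![((Finsupp.single 1 1, 0) + (Finsupp.single 0 (-1), 0)), ((Finsupp.single 0 1, 0) + (Finsupp.single (-1) (-1), 0)), ((Finsupp.single 0 1, 0) + (Finsupp.single (-1) (-1), 0)), ((Finsupp.single 0 1, 0) + (Finsupp.single (-1) (-1), 0))], ![((Finsupp.single 1 1, 0) + (Finsupp.single 0 (-1), 0)), ((Finsupp.single 2 1, 0) + (Finsupp.single 1 (-1), 0)), ((Finsupp.single 2 1, 0) + (Finsupp.single 1 (-1), 0)), ((Finsupp.single 2 1, 0) + (Finsupp.single 1 (-1),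 0))], ![(0, Finsupp.single 0 1), (0, Finsupp.single 0 1), ((Finsupp.single 1 1, 0) + (Finsupp.single 0 (-1), 0)), ((Finsupp.single 1 1, 0) + (Finsupp.single 0 (-1), 0))], ![(0, Finsupp.single 1 1), (0, Finsupp.single 1 1), ((Finsupp.single 1 1, 0) + (Finsupp.single 0 (-1), 0)), ((Finsupp.single 1 1, 0) + (Finsupp.single 0 (-1), 0))], ![(Finsupp.single 0 1, 0), ((Finsupp.single 1 1, 0) + (Finsupp.single 0 (-1), 0)), ((Finsupp.single 1 1, 0) + (Finsupp.single 0 (-1), 0)), ((Finsupp.single 1 1, 0) + (Finsupp.single 0 (-1), 0))], ![(Finsupp.single 1 1, 0), ((Finsupp.single 1 1, 0) + (Finsupp.single 0 (-1), 0)), ((Finsupp.single 1 1, 0) + (Finsupp.single 0 (-1), 0)), ((Finsupp.single 1 1, 0) + (Finsupp.single 0 (-1), 0))], ![((Finsupp.single 2 1, 0) + (Finsupp.single 1 (-1), 0)), ((Finsupp.single 1 1, 0) + (Finsupp.single 0 (-1), 0)), ((Finsupp.single 1 1, 0) + (Finsupp.single 0 (-1), 0)), ((Finsupp.single 1 1,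 0) + (Finsupp.single 0 (-1), 0))], ![((Finsupp.single 0 1, 0) + (Finsupp.single (-1) (-1), 0)), ((Finsupp.single 1 1, 0) + (Finsupp.single 0 (-1), 0)), ((Finsupp.single 1 1, 0) + (Finsupp.single 0 (-1), 0)), ((Finsupp.single 1 1, 0) + (Finsupp.single 0 (-1), 0))]] : Fin 10 → Fin 4 → TestFn) j) σ) +
        (∑ j : Fin 10, (![3 * a / 2 * (greenFn ω₂ 1 - greenFn ω₂ 0), -(3 * a / 2 * (greenFn ω₂ 1 - greenFn ω₂ 0)), 3 * a / 2 * greenFn ω₂ 0 + 3 * b * ω₂ / 2 * (2 * greenFn ω₂ 0 - 2 * greenFn ω₂ 1), 3 * a / 2 * greenFn ω₂ 0 + 3 * b * ω₂ / 2 * (2 * greenFn ω₂ 0 - 2 * greenFn ω₂ 1), 3 * b / 2 * (2 * greenFn ω₂ 1 - greenFn ω₂ 0 - greenFn ω₂ 2), -(3 * b / 2 * (2 * greenFn ω₂ 1 - greenFn ω₂ 0 - greenFn ω₂ 2)), 3 * b * (2 * greenFn ω₂ 0 - 2 * greenFn ω₂ 1), -(3 * b * (2 * greenFn ω₂ 0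 - 2 * greenFn ω₂ 1)), 3 * b / 2 * (2 * greenFn ω₂ 0 - 2 * greenFn ω₂ 1), -(3 * b / 2 * (2 * greenFn ω₂ 0 - 2 * greenFn ω₂ 1))] : Fin 10 → ℝ) j * wick ω₂ 1 2 ((![![(Finsupp.single 0 1, 0), (Finsupp.single 0 1, 0)], ![(Finsupp.single 1 1, 0), (Finsupp.single 1 1, 0)], ![((Finsupp.single 1 1, 0) + (Finsupp.single 0 (-1), 0)), (Finsupp.single 0 1, 0)], ![((Finsupp.single 1 1, 0) + (Finsupp.single 0 (-1), 0)), (Finsupp.single 1 1, 0)], ![((Finsupp.single 0 1, 0) + (Finsupp.single (-1) (-1), 0)), ((Finsupp.single 0 1, 0) + (Finsupp.single (-1) (-1), 0))], ![((Finsupp.single 2 1, 0) + (Finsupp.single 1 (-1), 0)), ((Finsupp.single 2 1, 0) + (Finsupp.single 1 (-1), 0))], ![((Finsupp.single 1 1, 0) + (Finsupp.single 0 (-1), 0)), ((Finsupp.single 0 1, 0) + (Finsupp.single (-1) (-1), 0))], ![((Finsupp.single 1 1, 0) + (Finsupp.single 0 (-1), 0)), ((Finsupp.single 2 1, 0) +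 (Finsupp.single 1 (-1), 0))], ![(0, Finsupp.single 0 1), (0, Finsupp.single 0 1)], ![(0, Finsupp.single 1 1), (0, Finsupp.single 1 1)]] : Fin 10 → Fin 2 → TestFn) j) σ) + 0) σ := by
  simp only []
  rw [firstOrderForce_apply]
  simp only [Fin.sum_univ_succ, Fin.sum_univ_zero, Matrix.cons_val_zero,
    Matrix.cons_val_one, Matrix.cons_val_succ, Matrix.cons_val, wick_four, wick_two, linObs_add, linObs_tq,
    linObs_tp, thermalCov_add_left, thermalCov_add_right, thermalCov_tq_tq, thermalCov_tp_tp,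
    thermalCov_tp_tq, Finsupp.single_apply]
  norm_num [greenFn_neg]
  ring

end Summit.AtomisticToContinuum.FouriersLaw.Theorems.DrudeDissolution.GramPencilHarmonicChaos

end
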